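import Literature.AnabelianGeometry.EtaleTheta.Discharge.Sec5Cor512ModelCase
import Literature.AnabelianGeometry.EtaleTheta.Discharge.Sec5Cor512UniversalClosureRefuted
import Literature.AnabelianGeometry.EtaleTheta.ThetaFrobenioidOfModel
import Literature.AlgebraicGeometry.Frobenioids.DegreeModelFrobenioid
import Mathlib.Topology.Instances.ZMod
import Mathlib.Algebra.Field.ZMod
import HarnessLib

/-!
# [EtTh] Corollary 5.12 at a MODEL Frobenioid: a §5 datum over the model Frobenioid of `(pt, ℕ, 0, 0)` at which the
# model-case instance forms FIRE — (i), (ii), (iii) HOLD in the kernel (non-vacuity / instantiation witness)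

Mochizuki, *The étale theta function and its Frobenioid-theoretic manifestations*, Publ. RIMS **45** (2009),
Corollary 5.12 (i)–(iii) pp.339–341 (PDF pp.113–115) [cite: MochizukiEtTh2009, Cor 5.12 p.339–341 (PDF pp.113–115)];
*The geometry of Frobenioids I*, Kyushu J. Math. **62** (2008), Thm. 5.2 [cite: MochizukiFrdI2008, Thm. 5.2 p.100–101].

abc-iut cell, block F, seat abc-iut-f-112 (gen 2); sequel of `Discharge/Sec5Cor512ModelCase.lean` (p436682: the
R5 instance forms `RootMorphismData.existsLinearIota_of_model` / `isoClassesDistinct_of_model` /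
`constantMultipleIndeterminacy(OfSystems)_of_model` for §5 data over `ModelFrobenioid Φ B Div_B` with
`𝔉.pre = PreFrobenioidData.ofModel Φ B Div_B`).  FACT-LIST rows F-0505 / F-0503 / F-0501 / F-0502.

WHAT THIS FILE SHOWS.  The hypotheses of those instance forms are JOINTLY SATISFIABLE by §5 data over a GENUINE
model Frobenioid, and at such data Corollary 5.12 (i), (ii), (iii) HOLD (kernel) — in contrast with gen 0's
data-only toy `Cor512Toy.toyRoot` (p428826) at which all three FAIL.  The carrier is abc-iut-L1-d4's
`DegreeModel.C` (`DegreeModelFrobenioid.lean`): the model Frobenioid ([FrdI] Thm. 5.2) of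
`(D, Φ, B, Div_B) = (Discrete Unit, (ℕ,+), 0, 0)` — "objects are integers `d` (the degree), an arrow `d → e` of
Frobenius degree `k` exists iff `k·d ≤ e` and is then unique" — which IS a Frobenioid (`DegreeModel.hF`) of standard
type (`DegreeModel.isOfStandardType`).  Over it:
* `Cor512ModelToy.thetaModel : ThetaFrobenioid DegreeModel.C DegreeModel.D` — a §5 datum whose Frobenioid-level
  vocabulary IS the model's (abc-iut-L2-t9's `TemperedFrobenioidStub.ofModel`, so `thetaModel.pre =
  PreFrobenioidData.ofModel …` by `rfl`): `A_⊚ = A_N := ι 0` (degree `0`, the zero section — Frobenius-trivial),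
  `B_N := ι 2`, `s^⊓_N = s^⊔_N :=` the degree-`1` arrow `ι 0 → ι 2` (a pre-step), `N = 1`, `l = 1`,
  `Π^tp_X = ℤ × ℤ/2` (discrete), `Π^tp_Ÿ = 1`, `K = 𝔽₂`, all sections trivial (as in gen 0's toys);
* `Cor512ModelToy.rootModel : RootMorphismData thetaModel vocabModel` — `N' = 2` (`M = 2`), `A_{N'} := ι 0`,
  `B_{N'} := ι 1`, `s^⊓_{N'} = s^⊔_{N'} :=` the degree-`1` arrow `ι 0 → ι 1`, `α_{N,N'} := (ι 0 → ι 0)` and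
  `β_{N,N'} := (ι 1 → ι 2)` the arrows of Frobenius degree `2` — isometries (`2·0 = 0`, `2·1 = 2`), the two
  squares commuting because arrows of `DegreeModel.C` are determined by their degree;
* every binder of the model-case theorems DISCHARGED: `Φ = ℕ` divisorial, `B = 0` group-like (abc-iut-L1-d4),
  `A_N` Frobenius-trivial (abc-iut-L1's `isFrobeniusTrivial_of_cls_eq_one`), `AutAmpleBN` and `hEnd` (the base has
  one arrow), "positive tensor powers nontrivial" = `deg(B_N) = 2 ≠ 0`, `k·deg(B_{N'}) = k ≠ 0`;
* hence **`rootModel_constantMultipleIndeterminacyOfSystems`** (Cor. 5.12 in full), **`rootModel_isoClassesDistinct`**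
  (i), **`rootModel_existsLinearIota`** (ii) — by `constantMultipleIndeterminacyOfSystems_of_model`.

HONEST LABEL: DEGENERATE geometry (one base point, divisors = degrees, no units, trivial Galois data; the bi-Kummer
vocabulary stub is the trivially-true one, which the Cor. 5.12 statements do not consult) — an instantiation /
non-vacuity witness for the model-case closers, NOT the theta Frobenioid of a curve; nothing here bears on
[IUTchIII] Cor. 3.12; no side taken; typed ≠ proved except the theorems below.
-/

noncomputable section

namespace Literature.AnabelianGeometry.EtaleTheta

namespace ConstantMultiple

namespace Cor512ModelToy

open CategoryTheory Opposite
open Literature.AlgebraicGeometry.Frobenioids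
open Literature.AlgebraicGeometry.Frobenioids.DegreeModel
open Cor512Toy (Mm kerFstEquiv)

/-! ### The §5 datum over `DegreeModel.C` -/

/-- `Φ = (ℕ,+)` is objectwise integral (needed by `TemperedFrobenioidStub.ofModel` for `O^×(S) ↪ O^×(S^birat)`).
[cite: MochizukiFrdI2008, Def. 1.1 (i) p.19] -/
theorem isIntegral_natΦ : ∀ A : Dᵒᵖ, IsIntegral (natΦ.obj A) :=
  fun A => (objectwise_isDivisorial_natΦ A.unop).isPreDivisorial.isIntegral

/-- The Frobenioid-level §5 vocabulary of `DegreeModel.C` = the model's ([EtTh] Def. 3.6 (ii) / [FrdI] Thm. 5.2 (ii);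
abc-iut-L2-t9's `TemperedFrobenioidStub.ofModel`, every arrow "of base-Frobenius type").
[cite: MochizukiEtTh2009, Def 3.6 p.303 (PDF p.77)] -/
def stubModel : FrobenioidTheta.TemperedFrobenioidStub.{0} C D :=
  FrobenioidTheta.TemperedFrobenioidStub.ofModel natΦ B DivB isIntegral_natΦ ⊤

/-- The degree-`k` arrow `ι d → ι e` of `DegreeModel.C` for `k·d ≤ e` (abc-iut-L1-d4's `homOf` at the objects `ι`).
[cite: MochizukiFrdI2008, Thm. 5.2 (i) p.100] -/
def arrow (d e : ℤ) (k : ℕ+) (h : (k : ℕ) * d ≤ e) : ι d ⟶ ι e :=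
  homOf (ι d) (ι e) k (by rw [dg_ι, dg_ι]; exact h)

/-- `deg_Fr` of `arrow`. [cite: MochizukiFrdI2008, Thm. 5.2 (i) p.100] -/
@[simp] theorem degFr_arrow (d e : ℤ) (k : ℕ+) (h : (k : ℕ) * d ≤ e) :
    ModelFrobenioid.degFr (arrow d e k h) = k := rfl

/-- `Div` of `arrow` is `e − k·d`. [cite: MochizukiFrdI2008, Thm. 5.2 (i) p.100] -/
theorem div_arrow (d e : ℤ) (k : ℕ+) (h : (k : ℕ) * d ≤ e) :
    ModelFrobenioid.div (arrow d e k h) = Multiplicative.ofAdd (e - (k : ℕ) * d).toNat := by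
  change Multiplicative.ofAdd (dg (ι e) - (k : ℕ) * dg (ι d)).toNat = _
  rw [dg_ι, dg_ι]

/-- An `arrow` with `e = k·d` is an isometry (`Div = 0`). [cite: MochizukiFrdI2008, Thm. 5.2 (i) p.100] -/
theorem div_arrow_eq_one (d e : ℤ) (k : ℕ+) (h : (k : ℕ) * d ≤ e) (hde : e = (k : ℕ) * d) :
    ModelFrobenioid.div (arrow d e k h) = 1 := by
  rw [div_arrow, hde, sub_self]
  rfl

/-- `s^⊓_N = s^⊔_N`: the degree-`1` arrow `ι 0 → ι 2`. [cite: MochizukiEtTh2009, §5 p.330 (PDF p.104)] -/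
def sN : ι 0 ⟶ ι 2 := arrow 0 2 1 (by decide)

/-- `s^⊓_{N'} = s^⊔_{N'}`: the degree-`1` arrow `ι 0 → ι 1`. [cite: MochizukiEtTh2009, Cor 5.12 p.339 (PDF p.113)] -/
def sN' : ι 0 ⟶ ι 1 := arrow 0 1 1 (by decide)

/-- `α_{N,N'}`: the degree-`2` arrow `ι 0 → ι 0`. [cite: MochizukiEtTh2009, Cor 5.12 p.339 (PDF p.113)] -/
def αM : ι 0 ⟶ ι 0 := arrow 0 0 2 (by decide)

/-- `β_{N,N'}`: the degree-`2` arrow `ι 1 → ι 2`. [cite: MochizukiEtTh2009, Cor 5.12 p.339 (PDF p.113)] -/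
def βM : ι 1 ⟶ ι 2 := arrow 1 2 2 (by decide)

/-- Every arrow of the base `D = Discrete Unit` between the bases of two objects is an isomorphism.
[cite: MochizukiFrdI2008, §0 p.14] -/
theorem isIso_baseMap {X Y : C} (φ : X ⟶ Y) : IsIso (ModelFrobenioid.baseMap φ) := isIso_D _

/-- **The §5 datum over the model Frobenioid of `(pt, ℕ, 0, 0)`** (every field of abc-iut-L2-t4's `ThetaFrobenioid`
supplied; Frobenioid-level vocabulary = the model's): `A_⊚ = A_N := ι 0`, `B_N := ι 2`, `s^⊓_N = s^⊔_N := (ι 0 → ι 2)`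
of degree `1`, `N = l = 1`, `Π^tp_X = ℤ × ℤ/2`, `Π^tp_Ÿ = 1`, `K = 𝔽₂`, trivial sections and constants.
[cite: MochizukiEtTh2009, §5 p.322–331 (PDF pp.96–105)] -/
def thetaModel : ThetaFrobenioid.{0} C D where
  toTemperedFrobenioidStub := stubModel
  lDelta := fun _ => Unit
  lDeltaMap := fun _ => MonoidHom.id Unit
  l := 1
  odd_l := odd_one
  N := 1
  Acirc := ι 0
  AN := ι 0
  BN := ι 2
  sCap := sN
  sCup := sN
  base_map_sCap := rfl
  isPreStep_sCap := ⟨rfl, isIso_baseMap _⟩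
  isPreStep_sCup := ⟨rfl, isIso_baseMap _⟩
  PiX := Multiplicative ℤ × Mm
  zquot := MonoidHom.fst _ _
  zquot_surjective := fun z => ⟨(z, 1), rfl⟩
  PiYdd := ⊥
  PiYdd_le := bot_le
  relindex_PiYdd := by
    rw [Subgroup.relIndex_bot_left, Nat.card_congr kerFstEquiv, Nat.card_zmod]
  PiYdd_normal := inferInstance
  isOpen_PiYdd := isOpen_discrete _
  ρ := 1
  ρ_surjective := fun g => ⟨1, Aut.ext (Subsingleton.elim _ _)⟩
  isOpen_ker_ρ := isOpen_discrete _
  strv := 1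
  sgpCap := 1
  sgpCup := 1
  K := ZMod 2
  constEmb := 1
  constEmb_injective := by
    intro a b _
    have h : ∀ u : (ZMod 2)ˣ, u = 1 := by decide
    rw [h a, h b]
  thetaFn := 1

/-- The bi-Kummer vocabulary over the datum: the trivially-true stub (the Cor. 5.12 statements do not consult it).
[cite: MochizukiEtTh2009, Prop 5.2 p.324 (PDF p.98)] -/
def vocabModel : FrobenioidThetaBiKummer.BiKummerVocabStub thetaModel where
  IsRootOfRightFractionPair := fun _ _ _ _ _ _ _ => True
  IsRootOf := fun _ _ _ _ _ => True

/-- The datum's Frobenioid-level operations ARE the model's (`rfl`): the standing hypothesis `h𝔉` of the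
model-case theorems.  [cite: MochizukiEtTh2009, Def 3.6 p.303 (PDF p.77)] -/
theorem thetaModel_pre : thetaModel.pre = PreFrobenioidData.ofModel natΦ B DivB := rfl

/-- `A_N = ι 0`. [cite: MochizukiEtTh2009, §5 p.330 (PDF p.104)] -/
theorem thetaModel_AN : thetaModel.AN = ι 0 := rfl

/-- `B_N = ι 2`. [cite: MochizukiEtTh2009, §5 p.330 (PDF p.104)] -/
theorem thetaModel_BN : thetaModel.BN = ι 2 := rfl

/-- **The Corollary 5.12 datum over it**: `N' = 2` (`M = N'/N = 2 ≠ 1`), `A_{N'} := ι 0`, `B_{N'} := ι 1`,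
`s^⊓_{N'} = s^⊔_{N'} := (ι 0 → ι 1)` of degree `1`, `α_{N,N'} := (ι 0 → ι 0)` and `β_{N,N'} := (ι 1 → ι 2)` of
Frobenius degree `2` (isometries: `Div = 0 − 2·0 = 0`, `2 − 2·1 = 0`); the squares commute since arrows of
`DegreeModel.C` are determined by domain, codomain and degree (`hom_eq_of_degFr_eq`).
[cite: MochizukiEtTh2009, Cor 5.12 p.339 (PDF p.113)] -/
def rootModel : RootMorphismData thetaModel vocabModel where
  N' := 2
  dvd := ⟨2, rfl⟩
  ne := by decide
  AN' := ι 0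
  BN' := ι 1
  sCap' := sN'
  sCup' := sN'
  isRoot := ⟨ι 0, 1, trivial, trivial⟩
  α := αM
  β := βM
  comm_sCap := hom_eq_of_degFr_eq _ _ (by decide)
  comm_sCup := hom_eq_of_degFr_eq _ _ (by decide)
  isIsometry_α := div_arrow_eq_one 0 0 2 (by decide) (by decide)
  degFr_α := rfl
  isIsometry_β := div_arrow_eq_one 1 2 2 (by decide) (by decide)
  degFr_β := rfl
  baseFrob_α := trivial
  constEmb' := 1

/-- `A_{N'} = ι 0`. [cite: MochizukiEtTh2009, Cor 5.12 p.339 (PDF p.113)] -/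
theorem rootModel_AN' : rootModel.AN' = ι 0 := rfl

/-- `B_{N'} = ι 1`. [cite: MochizukiEtTh2009, Cor 5.12 p.339 (PDF p.113)] -/
theorem rootModel_BN' : rootModel.BN' = ι 1 := rfl

/-! ### The binders of the model-case theorems, discharged -/

/-- `A_N = A_{N'} = ι 0 = (pt, 0)` is Frobenius-trivial ([FrdI] Thm. 5.2 proof p.101: the zero section; abc-iut-L1's
`isFrobeniusTrivial_of_cls_eq_one`).  [cite: MochizukiFrdI2008, Thm. 5.2 p.101] -/
theorem isFrobeniusTrivial_ι_zero : thetaModel.IsFrobeniusTrivial (ι 0) := by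
  show (PreFrobenioidData.ofModel natΦ B DivB).IsFrobeniusTrivial (ι 0)
  exact (PreFrobenioidData.ofFunctor_isFrobeniusTrivial _ _).mpr
    (ModelFrobenioid.isFrobeniusTrivial_of_cls_eq_one objectwise_isGroupLike_B (ι 0) (zpow_zero gen))

/-- `B_N` is Aut-ample (`Aut_D(pt) = 1`).  [cite: MochizukiEtTh2009, §5 p.330 (PDF p.104)] -/
theorem autAmpleBN : thetaModel.AutAmpleBN := fun _ => ⟨1, Aut.ext (Subsingleton.elim _ _)⟩

/-- Every `D`-endomorphism of `B_N^bs = pt` is an isomorphism.  [cite: MochizukiFrdI2008, §0 p.14] -/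
theorem isIso_end_BN (φ : thetaModel.base.obj thetaModel.BN ⟶ thetaModel.base.obj thetaModel.BN) : IsIso φ :=
  isIso_D φ

/-- "The line bundle of `B_N` is nontrivial": the class of `ι 2` is not `0 = Div_B(u)` (degree `2 ≠ 0`).
[cite: MochizukiEtTh2009, Cor 5.12 proof p.341 (PDF p.115)] -/
theorem cls_BN_ne (u : B.obj (op (ι 2).base)) : (ι 2).cls ≠ divB natΦ B DivB (op (ι 2).base) u := by
  intro h
  rw [divB_eq_one] at h
  have h' : DegreeModel.cls (ι 2) = 1 := h
  have h2 : dg (ι 2) = 2 := dg_ι 2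
  unfold dg at h2
  rw [h', map_one, toAdd_one] at h2
  exact absurd h2 (by decide)

/-- "All positive tensor powers of the line bundle of `B_{N'}` are nontrivial": no positive power of the class of
`ι 1` is `0 = Div_B(u)` (degree `k ≠ 0`).  [cite: MochizukiEtTh2009, Cor 5.12 proof p.341 (PDF p.115)] -/
theorem cls_BN'_pow_ne (k : ℕ) (hk : 0 < k) (u : B.obj (op (ι 1).base)) :
    (ι 1).cls ^ k ≠ divB natΦ B DivB (op (ι 1).base) u := by
  intro h
  rw [divB_eq_one] at h
  have h' : DegreeModel.cls (ι 1) ^ k = 1 := h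
  have h1 : dg (ι 1) = 1 := dg_ι 1
  unfold dg at h1
  have hk' : Multiplicative.toAdd (deg (DegreeModel.cls (ι 1) ^ k)) = Multiplicative.toAdd (deg 1) :=
    congrArg (fun c => Multiplicative.toAdd (deg c)) h'
  rw [map_pow, toAdd_pow, h1, map_one, toAdd_one, nsmul_eq_mul, mul_one] at hk'
  omega

/-- `s^⊓_{N'} = (ι 0 → ι 1)` of degree `1` is a pre-step (linear base-isomorphism).
[cite: MochizukiEtTh2009, Prop 4.2 (iii) p.314 (PDF p.88)] -/
theorem isPreStep_sCap' : thetaModel.IsPreStep rootModel.sCap' := ⟨rfl, isIso_baseMap _⟩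

/-! ### Corollary 5.12 HOLDS at the datum, by the model-case instance forms -/

/-- **[EtTh] Cor. 5.12 (i) ∧ (ii) ∧ (iii) HOLD at the model datum** (`ConstantMultipleIndeterminacyOfSystems`), by
`RootMorphismData.constantMultipleIndeterminacyOfSystems_of_model` (p436682) with every binder discharged above —
the instance forms are not vacuous.  [cite: MochizukiEtTh2009, Cor 5.12 p.339–341 (PDF pp.113–115)] -/
theorem rootModel_constantMultipleIndeterminacyOfSystems : ConstantMultipleIndeterminacyOfSystems rootModel :=
  rootModel.constantMultipleIndeterminacyOfSystems_of_model thetaModel_pre objectwise_isDivisorial_natΦ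
    objectwise_isGroupLike_B isFrobeniusTrivial_ι_zero isFrobeniusTrivial_ι_zero isPreStep_sCap' autAmpleBN
    isIso_end_BN cls_BN_ne cls_BN'_pow_ne

/-- **Cor. 5.12 (i) HOLDS at the model datum**: `ι 0`, `ι 2`, `ι 1` are pairwise non-isomorphic in `DegreeModel.C`
(F-0505 instance, kernel).  [cite: MochizukiEtTh2009, Cor 5.12 (i) p.339 (PDF p.113)] -/
theorem rootModel_isoClassesDistinct : IsoClassesDistinct rootModel :=
  rootModel_constantMultipleIndeterminacyOfSystems.1

/-- **Cor. 5.12 (ii) HOLDS at the model datum**: a linear `ι : B_{N'} = ι 1 → ι 2 = B_N` exists (F-0503 instance,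
kernel).  [cite: MochizukiEtTh2009, Cor 5.12 (ii) p.340 (PDF p.114)] -/
theorem rootModel_existsLinearIota : ExistsLinearIota rootModel :=
  rootModel_constantMultipleIndeterminacyOfSystems.2.1

/-- **Cor. 5.12 (iii) HOLDS at the model datum for `ζ = β_{N,N'}`** (F-0501 instance, kernel).
[cite: MochizukiEtTh2009, Cor 5.12 (iii) p.340 (PDF p.114)] -/
theorem rootModel_constantMultipleIndeterminacy_β : ConstantMultipleIndeterminacy rootModel rootModel.β :=
  rootModel_constantMultipleIndeterminacyOfSystems.2.2.1

end Cor512ModelToy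

end ConstantMultiple

end Literature.AnabelianGeometry.EtaleTheta

end
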